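import Mathlib

/-!
# Line `channel_covering` of crux `OrbitDimensionBound` (stmt-ValiantsHypothesis-16133): the stub
`stub_servedCount` is FALSE AS TYPED — degenerate (zero) grades

Negative-lane lemma (val-lit-p4 g11, 2026-08-28, helper mode).  The line
`Cruxes/OrbitDimensionBound/Lines/channel_covering.lean` (rung `Channel.OneChannelShadow`) registers three stubs;
the third, `stub_servedCount : Stmt.stub_servedCount`, says: if `(d, e)` is a generic element of `T_Λ` (`IsGeneric`)
and EVERY permutation `σ ∈ 𝔖_n` is SERVED by the grades `α, β : Fin m → ℂ` (`Served`: `β_i = chainWt(σ|T) · α_j` for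
some `⌊n/2⌋`-set `T`, or the two-chain variant from the fixed sources `s₁, s₂`), then `C(n, ⌊n/2⌋) ≤ m · (n·m) · 4^r`.

The grades are typed as arbitrary complex numbers and NO clause of the line makes them non-zero (the graded form
`IsGradedChannelForm` only records implications «entry ≠ 0 ⇒ β_i = w · α_j»).  With `α = β = 0` every permutation is
served trivially (`0 = chainWt · 0`), so at `n = 4`, `m = 1`, `r = 0` (no relations; `(d, e)` = eight distinct primes,
a generic point of the torus: no multiplicative relation at all) all hypotheses hold while the conclusion reads
`C(4,2) = 6 ≤ 4`.  Hence `stub_servedCount_false` below (the statement is `Stmt.stub_servedCount` with `IsGeneric`,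
`Served`, `chainWt` unfolded, negated).

CLASSIFICATION: misstated, not substantive.  In the line's composition the grades come from `stub_channelGradedForm`,
i.e. (tree proof `Theorems/FreeSubtorusOrbitDimensionBoundStubChannelGradedForm.lean`) from `exists_gradedForm`: they
are generalised EIGENVALUES of the lifts `g, h ∈ GL_m(ℂ)`, hence non-zero — but the typed `IsGradedChannelForm` forgets
this.  REPAIRED STATEMENT (believed to be the intended one; still open, size M as the card says): add the hypothesis
`∀ j, α j ≠ 0` (or type the grades in `ℂˣ`) to `Stmt.stub_servedCount` — then a label `(i, j)` determines the chain
weight `β_i / α_j`, equal-weight level pairs are confused by `IsGeneric` (iii), and the card's count (Odlyzko twice,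
tree `confusionNumber_le_two_pow`) applies; `stub_channelGradedForm` must then export the non-vanishing, which
`exists_gradedForm`'s multiplicity clauses provide (an invertible map has no eigenvalue `0`).  The witness below has
`α = 0` and misses the repaired statement.  Nothing here bears on the crux `OrbitDimensionBound`, the route
`FreeSubtorus` or VP ≠ VNP: it records that the stub must be re-typed before anyone proves it «by name».
-/

namespace Summit.ValiantsHypothesis.ValiantsHypothesis.Theorems.OrbitDimensionBound.Negative

-- summit = sub-problem name (single-conjunct summit, D-0017 layout), so the namespace repeats it
set_option linter.dupNamespace false

open Finset

/-! ### Multiplicative independence of distinct primes (the generic torus point of the witness) -/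

/-- The exponent of the prime `p y` in `∏_x (p x)^{a x}` is `a y` when `p` is an injective family of primes. [folklore] -/
theorem factorization_prod_prime_pow {X : Type*} [Fintype X] [DecidableEq X] (p : X → ℕ) (hp : ∀ x, (p x).Prime)
    (hinj : Function.Injective p) (a : X → ℕ) (y : X) :
    (∏ x, p x ^ a x).factorization (p y) = a y := by
  rw [Nat.factorization_prod fun x _ => pow_ne_zero _ (hp x).ne_zero]
  simp only [Nat.factorization_pow, Finsupp.coe_finsetSum, Finsupp.coe_smul, Finset.sum_apply, Pi.smul_apply,
    smul_eq_mul]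
  rw [Finset.sum_eq_single y]
  · rw [(hp y).factorization, Finsupp.single_eq_same, mul_one]
  · intro x _ hxy
    rw [(hp x).factorization, Finsupp.single_eq_of_ne (fun h => hxy (hinj h.symm)), mul_zero]
  · intro hy
    exact absurd (Finset.mem_univ y) hy

/-- **Distinct primes are multiplicatively independent in `ℂˣ`:** `∏_x (p x)^{χ x} = 1` with `χ x ∈ ℤ` forces `χ = 0`.
[folklore] -/
theorem eq_zero_of_prod_prime_zpow_eq_one {X : Type*} [Fintype X] [DecidableEq X] (p : X → ℕ)
    (hp : ∀ x, (p x).Prime) (hinj : Function.Injective p) (U : X → ℂˣ) (hU : ∀ x, (U x : ℂ) = (p x : ℂ))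
    (χ : X → ℤ) (h : ∏ x, U x ^ χ x = 1) : χ = 0 := by
  -- split the exponents into positive and negative parts
  set a : X → ℕ := fun x => (χ x).toNat with ha
  set b : X → ℕ := fun x => (-χ x).toNat with hb
  have hχ : ∀ x, χ x = (a x : ℤ) - (b x : ℤ) := fun x => by
    simp only [ha, hb]
    omega
  have hsplit : ∏ x, U x ^ χ x = (∏ x, U x ^ a x) / ∏ x, U x ^ b x := by
    rw [← Finset.prod_div_distrib]
    refine Finset.prod_congr rfl fun x _ => ?_
    rw [hχ x, zpow_sub, zpow_natCast, zpow_natCast, div_eq_mul_inv]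
  rw [hsplit, div_eq_one] at h
  -- pass to natural numbers
  have hval : ∀ c : X → ℕ, ((∏ x, U x ^ c x : ℂˣ) : ℂ) = ((∏ x, p x ^ c x : ℕ) : ℂ) := by
    intro c
    rw [Units.coe_prod, Nat.cast_prod]
    refine Finset.prod_congr rfl fun x _ => ?_
    rw [Units.val_pow_eq_pow_val, hU x, Nat.cast_pow]
  have hnat : ∏ x, p x ^ a x = ∏ x, p x ^ b x := by
    have := congrArg (fun u : ℂˣ => (u : ℂ)) h
    simp only [hval] at this
    exact_mod_cast this
  -- compare exponents prime by prime
  funext y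
  have hy : a y = b y := by
    rw [← factorization_prod_prime_pow p hp hinj a y, ← factorization_prod_prime_pow p hp hinj b y, hnat]
  have h1 : (χ y).toNat = (-χ y).toNat := hy
  simp only [Pi.zero_apply]
  omega

/-- A product of powers of integers `≥ 2` with a non-zero exponent vector is an integer `≠ 1` (in `ℂ`). [folklore] -/
theorem prod_cast_pow_ne_one {Y : Type*} [Fintype Y] (q : Y → ℕ) (hq : ∀ y, 2 ≤ q y) (u : Y → ℕ) (hu : u ≠ 0) :
    (∏ y, ((q y : ℕ) : ℂ) ^ (u y)) ≠ 1 := by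
  obtain ⟨y₀, hy₀⟩ : ∃ y, u y ≠ 0 := by
    by_contra hcon
    push Not at hcon
    exact hu (funext hcon)
  have hnat : 2 ≤ ∏ y, q y ^ u y := by
    calc 2 ≤ q y₀ ^ u y₀ := by
          calc 2 ≤ q y₀ := hq y₀
            _ = q y₀ ^ 1 := (pow_one _).symm
            _ ≤ q y₀ ^ u y₀ := Nat.pow_le_pow_right (by linarith [hq y₀]) (Nat.one_le_iff_ne_zero.mpr hy₀)
      _ ≤ ∏ y, q y ^ u y :=
          Finset.single_le_prod' (fun y _ => Nat.one_le_iff_ne_zero.mpr (pow_ne_zero _ (by linarith [hq y])))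
            (Finset.mem_univ y₀)
  have hcast : (∏ y, ((q y : ℕ) : ℂ) ^ (u y)) = ((∏ y, q y ^ u y : ℕ) : ℂ) := by
    rw [Nat.cast_prod]
    exact Finset.prod_congr rfl fun y _ => (Nat.cast_pow _ _).symm
  rw [hcast]
  exact_mod_cast (show (∏ y, q y ^ u y) ≠ 1 by omega)

/-! ### The refutation -/

/-- **The stub `stub_servedCount` of the line `channel_covering` (crux `OrbitDimensionBound`, 16133) is false as
typed.**  Statement = `¬ Stmt.stub_servedCount` with the line's `IsGeneric`, `Served`, `chainWt` unfolded.  Witness: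
`n = 4`, `m = 1`, `r = 0`, `(d, e)` = the primes `(2,3,5,7 ; 11,13,17,19)` as units of `ℂ`, grades `α = β = 0`, sources
`s₁ = s₂ = 0`: every `σ` is served by `T = {0, 1}` (`0 = chainWt · 0`), genericity holds (no relations, `r = 0`; a
product of prime powers is `1` only for zero exponents), and `C(4,2) = 6 > 4 = 1 · (4 · 1) · 4^0`.  Repaired statement
(open): add `∀ j, α j ≠ 0`; this witness misses it. -/
theorem stub_servedCount_false :
    ¬ (∀ (n m r : ℕ) (Λ : Fin r → (Fin n ⊕ Fin n) → ℤ) (d e : Fin n → ℂˣ) (α β : Fin m → ℂ) (s₁ s₂ : Fin m),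
        3 ≤ n → (∀ i, (∑ k, Λ i (Sum.inl k)) = 0 ∧ (∑ l, Λ i (Sum.inr l)) = 0) →
        ((∀ i, (∏ k, (d k) ^ (Λ i (Sum.inl k))) * (∏ l, (e l) ^ (Λ i (Sum.inr l))) = 1) ∧
          (∀ u : Fin n × Fin n → ℕ, u ≠ 0 → (∏ p, ((d p.1 : ℂ) * (e p.2 : ℂ)) ^ (u p)) ≠ 1) ∧
          (∀ χ : (Fin n ⊕ Fin n) → ℤ,
            (∏ k, (d k) ^ (χ (Sum.inl k))) * (∏ l, (e l) ^ (χ (Sum.inr l))) = 1 →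
            ∃ (N : ℤ) (a : Fin r → ℤ), N ≠ 0 ∧ N • χ = ∑ i, a i • Λ i)) →
        (∀ σ : Equiv.Perm (Fin n),
          (∃ (i j : Fin m) (T : Finset (Fin n)), T.card = n / 2 ∧
              β i = (∏ k ∈ T, ((d k : ℂ) * (e (σ k) : ℂ))) * α j) ∨
          (∃ (j₁ j₂ : Fin m) (T₁ T₂ : Finset (Fin n)), Disjoint T₁ T₂ ∧ T₁.card + T₂.card = n / 2 ∧
              β s₁ = (∏ k ∈ T₁, ((d k : ℂ) * (e (σ k) : ℂ))) * α j₁ ∧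
              β s₂ = (∏ k ∈ T₂, ((d k : ℂ) * (e (σ k) : ℂ))) * α j₂)) →
        Nat.choose n (n / 2) ≤ m * (n * m) * 2 ^ (2 * r)) := by
  intro h
  -- the generic torus point: eight distinct primes
  let P : Fin 4 ⊕ Fin 4 → ℕ := Sum.elim ![2, 3, 5, 7] ![11, 13, 17, 19]
  have hP : ∀ x, (P x).Prime := by
    intro x
    rcases x with x | x <;> fin_cases x <;> simp [P] <;> norm_num
  have hPinj : Function.Injective P := by decide
  have hP2 : ∀ x, 2 ≤ P x := fun x => (hP x).two_le
  have hP0 : ∀ x, ((P x : ℕ) : ℂ) ≠ 0 := fun x => by exact_mod_cast (hP x).ne_zero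
  let U : Fin 4 ⊕ Fin 4 → ℂˣ := fun x => Units.mk0 ((P x : ℕ) : ℂ) (hP0 x)
  have hU : ∀ x, (U x : ℂ) = (P x : ℂ) := fun x => rfl
  let d : Fin 4 → ℂˣ := fun k => U (Sum.inl k)
  let e : Fin 4 → ℂˣ := fun l => U (Sum.inr l)
  have key := h 4 1 0 (fun i => Fin.elim0 i) d e 0 0 0 0 (by norm_num) (fun i => Fin.elim0 i)
    ⟨fun i => Fin.elim0 i, ?_, ?_⟩ ?_
  · -- `C(4,2) = 6 ≤ 4` is absurd
    exact absurd key (by decide)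
  · -- genericity (ii): a non-empty product of the weights `d_k e_l ≥ 22` is not `1`
    intro u hu
    have hw : ∀ p : Fin 4 × Fin 4, ((d p.1 : ℂ) * (e p.2 : ℂ)) = ((P (Sum.inl p.1) * P (Sum.inr p.2) : ℕ) : ℂ) := by
      intro p
      simp only [d, e, hU, Nat.cast_mul]
    simp_rw [hw]
    exact prod_cast_pow_ne_one (fun p : Fin 4 × Fin 4 => P (Sum.inl p.1) * P (Sum.inr p.2))
      (fun p => le_trans (hP2 _) (Nat.le_mul_of_pos_right _ (hP _).pos)) u hu
  · -- genericity (iii): no character relation at all, so `N = 1`, `a = ()`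
    intro χ hχ
    refine ⟨1, fun i => Fin.elim0 i, one_ne_zero, ?_⟩
    have hprod : ∏ x, U x ^ χ x = 1 := by
      rw [Fintype.prod_sum_type]
      exact hχ
    have h0 := eq_zero_of_prod_prime_zpow_eq_one P hP hPinj U hU χ hprod
    rw [h0, smul_zero, Finset.univ_eq_empty, Finset.sum_empty]
  · -- every permutation is served by the zero grades
    intro σ
    refine Or.inl ⟨0, 0, {0, 1}, by decide, ?_⟩
    simp

end Summit.ValiantsHypothesis.ValiantsHypothesis.Theorems.OrbitDimensionBound.Negative
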